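import Literature.Probability.LatticeModels.DobrushinMetricInfiniteRangeDefect
import HarnessLib

/-!
# Föllmer's comparison theorem with defects, infinite range: the Gibbs states of TWO specifications
(measure level)

[topic Probability/LatticeModels]

Measure-level instantiation of `DobrushinMetricInfiniteRangeDefect.lean` (Föllmer 1988, Ch. I,
Comparison Theorem (2.8) with (2.10), for an arbitrary countable index set and the infinite matrix
`C`): a specification `γ` whose one-site laws satisfy the GLOBAL Kantorovich–Rubinstein bound
`|∫ φ dγ_x(·|ω) - ∫ φ dγ_x(·|η)| ≤ L ∑' y, C x y · r(ω y, η y)` with SUMMABLE rows `∑' y, C x y ≤ c < 1`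
(no finite set of neighbours — e.g. the Gibbsian specification of an absolutely summable infinite-range
interaction), a Gibbs measure `μ` of `γ`, and a Gibbs measure `ν` of ANOTHER specification `γ'` whose
one-site law at `x` is `b x`-close to that of `γ`, uniformly in the boundary condition, in the
distance dual to `r`:

* `DobrushinMetric.abs_integral_sub_integral_le_of_gibbs_pair_tsum` — for every bounded super-solution
  `d ≥ 0` of `b x + ∑' y, C x y · d y ≤ d x` and every bounded measurable local `f` (dependence set `Δ`,
  coordinatewise Lipschitz vector `δ`): `|∫ f dμ − ∫ f dν| ≤ ∑_{y ∈ Δ} d y · δ y`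
  (Föllmer (2.8)/(2.10): `|μ f − μ̃ f| ≤ ∑_y (δ(f) D)_y b_y`, `D = ∑ₙ Cⁿ ≤` any super-solution;
  Georgii 2011, Thm. 8.20 / Remark 8.26; Gross 1981 — the infinite-range form of the tree's
  `abs_integral_sub_integral_le_of_gibbs_pair_local`).

The defect of `ν` against the one-site averaging of `γ` comes from the DLR equations of `ν` for `γ'_x`
and the kernel closeness tested on `s ↦ f(σ^{x←s})`, whose Lipschitz constant in the global class is
`δ x` (`r` vanishes on the diagonal). Theorems only; no named facts.

## References
* H. Föllmer, *Random fields and diffusion processes*, LNM 1362 (1988), Ch. I, (2.8), (2.10),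
  Remark (2.17).
* H.-O. Georgii, *Gibbs Measures and Phase Transitions*, 2nd ed. (2011), Thm. 8.20, Remark 8.26.
* L. Gross, J. Stat. Phys. 25 (1981) 57–72.
-/

noncomputable section

open MeasureTheory ProbabilityTheory Finset Function Filter
open scoped Topology

namespace Literature.Probability.LatticeModels

namespace DobrushinMetric

section States

variable {V S : Type*} [MeasurableSpace S] {γ γ' : Specification V S} {r : S → S → ℝ}
  {C : V → V → ℝ}

/-- **Comparison of the Gibbs states of two specifications, infinite range with summable rows,
site-dependent defect, through a super-solution** (Föllmer 1988, Ch. I, Comparison Theorem (2.8)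
with (2.10); Georgii 2011, Thm. 8.20): see the module docstring.
[cite: Follmer1988, Ch. I Comparison Theorem (2.8), (2.10)] -/
theorem abs_integral_sub_integral_le_of_gibbs_pair_tsum [DecidableEq V]
    (hγ : IsSpecification γ) (hγ' : IsSpecification γ') {R : ℝ} (hR : 0 ≤ R)
    (hr0 : ∀ a b, 0 ≤ r a b) (hrR : ∀ a b, r a b ≤ R) (hr00 : ∀ a, r a a = 0)
    (hC0 : ∀ x y, 0 ≤ C x y) (hCs : ∀ x, Summable (C x))
    (hcontr : ∀ (x : V) (ω η : V → S) (φ : S → ℝ) (L : ℝ), Measurable φ →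
      (∃ M, ∀ s, |φ s| ≤ M) → 0 ≤ L → (∀ a b, |φ a - φ b| ≤ L * r a b) →
      |∫ s, φ s ∂(siteLaw γ x ω) - ∫ s, φ s ∂(siteLaw γ x η)| ≤
        L * ∑' y, C x y * r (ω y) (η y))
    {c : ℝ} (hc0 : 0 ≤ c) (hc1 : c < 1) (hrow : ∀ x, ∑' y, C x y ≤ c)
    {μ : Measure (V → S)} (hμ : IsGibbsMeasure γ μ)
    {ν : Measure (V → S)} (hν : IsGibbsMeasure γ' ν) {b : V → ℝ} (hb0 : ∀ x, 0 ≤ b x)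
    (hker : ∀ (x : V) (η : V → S) (φ : S → ℝ) (L : ℝ), Measurable φ → (∃ M, ∀ s, |φ s| ≤ M) →
      0 ≤ L → (∀ a a', |φ a - φ a'| ≤ L * r a a') →
      |(∫ s, φ s ∂(siteLaw γ x η)) - ∫ s, φ s ∂(siteLaw γ' x η)| ≤ b x * L)
    {d : V → ℝ} {D : ℝ} (hd0 : ∀ y, 0 ≤ d y) (hdD : ∀ y, d y ≤ D)
    (hsuper : ∀ x, b x + ∑' y, C x y * d y ≤ d x)
    {f : (V → S) → ℝ} (hfm : Measurable f) {Δ : Finset V} (hfdep : DependsOn f (↑Δ : Set V))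
    {M : ℝ} (hM : ∀ σ, |f σ| ≤ M) {δ : V → ℝ} (hδ : IsLipBound r f δ) :
    |(∫ σ, f σ ∂μ) - ∫ σ, f σ ∂ν| ≤ ∑ y ∈ Δ, d y * δ y := by
  classical
  haveI := hμ.isProbabilityMeasure
  haveI := hν.isProbabilityMeasure
  -- the two predicates of the abstract layer
  set Adm : ((V → S) → ℝ) → Prop := fun F => Measurable F ∧ ∃ M, ∀ σ, |F σ| ≤ M with hAdmdef
  set Lip : ((V → S) → ℝ) → (V → ℝ) → Prop := fun F δ =>
    (∀ y, 0 ≤ δ y) ∧ Summable δ ∧ ∀ σ τ, |F σ - F τ| ≤ ∑' y, δ y * r (σ y) (τ y) with hLipdef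
  -- layer hypotheses (Föllmer's class `L(Ω)` and the dusting lemma)
  have hlip0 : ∀ ⦃F : (V → S) → ℝ⦄ ⦃δ : V → ℝ⦄, Lip F δ → ∀ y, 0 ≤ δ y := fun F δ h => h.1
  have hlips : ∀ ⦃F : (V → S) → ℝ⦄ ⦃δ : V → ℝ⦄, Lip F δ → Summable δ := fun F δ h => h.2.1
  have hosc : ∀ ⦃F : (V → S) → ℝ⦄ ⦃δ : V → ℝ⦄, Adm F → Lip F δ →
      ∀ σ τ, |F σ - F τ| ≤ R * ∑' y, δ y := by
    intro F δ _ h σ τ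
    obtain ⟨hδ0, hδs, hδ'⟩ := h
    refine (hδ' σ τ).trans ?_
    have hs : Summable fun y => δ y * r (σ y) (τ y) :=
      Summable.of_nonneg_of_le (fun y => mul_nonneg (hδ0 y) (hr0 _ _))
        (fun y => mul_le_mul_of_nonneg_left (hrR _ _) (hδ0 y)) (hδs.mul_right R)
    calc ∑' y, δ y * r (σ y) (τ y) ≤ ∑' y, δ y * R :=
          hs.tsum_le_tsum (fun y => mul_le_mul_of_nonneg_left (hrR _ _) (hδ0 y)) (hδs.mul_right R)
      _ = R * ∑' y, δ y := by rw [tsum_mul_right, mul_comm]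
  have hT : ∀ ⦃F : (V → S) → ℝ⦄ (x : V), Adm F → Adm (siteAvg γ x F) := by
    intro F x hF
    obtain ⟨hFm, B, hB⟩ := hF
    exact ⟨measurable_siteAvg hγ x hFm, B, fun σ => abs_siteAvg_le hγ x hB σ⟩
  have hdust : ∀ ⦃F : (V → S) → ℝ⦄ ⦃δ : V → ℝ⦄ (x : V), Adm F → Lip F δ →
      Lip (siteAvg γ x F) fun y => if y = x then 0 else δ y + C x y * δ x := by
    intro F δ x hF h
    obtain ⟨hFm, B, hB⟩ := hF
    obtain ⟨hδ0, hδs, hδ'⟩ := h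
    refine ⟨fun y => ?_, ?_, lip_siteAvg_tsum hγ hr0 hrR hr00 hC0 hCs hcontr x hFm hB hδ0 hδs hδ'⟩
    · dsimp only
      split_ifs
      · exact le_rfl
      · exact add_nonneg (hδ0 y) (mul_nonneg (hC0 x y) (hδ0 x))
    · exact Summable.of_nonneg_of_le
        (fun y => by
          split_ifs; exacts [le_rfl, add_nonneg (hδ0 y) (mul_nonneg (hC0 x y) (hδ0 x))])
        (fun y => by
          split_ifs
          · exact add_nonneg (hδ0 y) (mul_nonneg (hC0 x y) (hδ0 x))
          · exact le_rfl)
        (hδs.add ((hCs x).mul_right (δ x)))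
  -- `μ` is an invariant state, `ν` a state with defect `b`
  have hstate : ∀ {ρ : Measure (V → S)} [IsProbabilityMeasure ρ],
      (∀ ⦃F : (V → S) → ℝ⦄ ⦃M : ℝ⦄, Adm F → (∀ σ, F σ ≤ M) → ∫ σ, F σ ∂ρ ≤ M) ∧
      (∀ ⦃F : (V → S) → ℝ⦄ ⦃M : ℝ⦄, Adm F → (∀ σ, M ≤ F σ) → M ≤ ∫ σ, F σ ∂ρ) := by
    intro ρ _
    refine ⟨fun F M hF hM' => ?_, fun F M hF hM' => ?_⟩
    · obtain ⟨hFm, B, hB⟩ := hF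
      calc ∫ σ, F σ ∂ρ ≤ ∫ _σ, M ∂ρ := integral_mono (integrable_of_abs_le' hFm hB)
            (integrable_const M) hM'
        _ = M := by simp
    · obtain ⟨hFm, B, hB⟩ := hF
      calc M = ∫ _σ, M ∂ρ := by simp
        _ ≤ ∫ σ, F σ ∂ρ := integral_mono (integrable_const M) (integrable_of_abs_le' hFm hB) hM'
  obtain ⟨h₁le, h₁ge⟩ := hstate (ρ := μ)
  obtain ⟨h₂le, h₂ge⟩ := hstate (ρ := ν)
  have h₁T : ∀ ⦃F : (V → S) → ℝ⦄ (x : V), Adm F → ∫ σ, siteAvg γ x F σ ∂μ = ∫ σ, F σ ∂μ := by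
    intro F x hF
    obtain ⟨hFm, B, hB⟩ := hF
    exact hμ.integral_integral_eq hγ {x} (integrable_of_abs_le' hFm hB)
  have h₂D : ∀ ⦃F : (V → S) → ℝ⦄ ⦃δ : V → ℝ⦄ (x : V), Adm F → Lip F δ →
      |(∫ σ, siteAvg γ x F σ ∂ν) - ∫ σ, F σ ∂ν| ≤ b x * δ x := by
    intro F δ x hF h
    obtain ⟨hFm, Mg, hMg⟩ := hF
    obtain ⟨hδ0, hδs, hδ'⟩ := h
    have hDLR : ∫ σ, siteAvg γ' x F σ ∂ν = ∫ σ, F σ ∂ν :=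
      hν.integral_integral_eq hγ' {x} (integrable_of_abs_le' hFm hMg)
    have hi₁ : Integrable (siteAvg γ x F) ν :=
      integrable_of_abs_le' (measurable_siteAvg hγ x hFm) (abs_siteAvg_le hγ x hMg)
    have hi₂ : Integrable (siteAvg γ' x F) ν :=
      integrable_of_abs_le' (measurable_siteAvg hγ' x hFm) (abs_siteAvg_le hγ' x hMg)
    rw [← hDLR, ← integral_sub hi₁ hi₂]
    -- the test function `s ↦ F(σ^{x←s})` is `δ x`-Lipschitz in the global class
    have hψ : ∀ σ a a', |F (Function.update σ x a) - F (Function.update σ x a')| ≤ δ x * r a a' :=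
      fun σ a a' => by
      refine (hδ' _ _).trans (le_of_eq ?_)
      rw [tsum_eq_single x (fun y hyx => by
        rw [Function.update_of_ne hyx, Function.update_of_ne hyx, hr00, mul_zero])]
      simp
    have hpt : ∀ σ, |siteAvg γ x F σ - siteAvg γ' x F σ| ≤ b x * δ x := by
      intro σ
      rw [siteAvg_eq_integral_siteLaw hγ x hFm σ, siteAvg_eq_integral_siteLaw hγ' x hFm σ]
      exact hker x σ (fun s => F (Function.update σ x s)) (δ x) (hFm.comp (measurable_update σ))
        ⟨Mg, fun s => hMg _⟩ (hδ0 x) (hψ σ)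
    calc |∫ σ, (siteAvg γ x F σ - siteAvg γ' x F σ) ∂ν|
        ≤ ∫ σ, |siteAvg γ x F σ - siteAvg γ' x F σ| ∂ν := abs_integral_le_integral_abs
      _ ≤ ∫ _σ, b x * δ x ∂ν := integral_mono (hi₁.sub hi₂).abs (integrable_const _) hpt
      _ = b x * δ x := by simp
  -- the local observable `f` with the global Lipschitz vector `δ 𝟙_Δ`
  have hF : Adm f := ⟨hfm, M, hM⟩
  have hδ' : Lip f fun y => if y ∈ Δ then δ y else 0 := by
    refine ⟨fun y => ?_, ?_, fun σ τ => abs_sub_le_tsum_of_dependsOn hfdep hδ σ τ⟩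
    · dsimp only
      split_ifs
      · exact hδ.nonneg y
      · exact le_rfl
    · exact summable_of_ne_finset_zero (s := Δ) fun y hy => if_neg hy
  have key := abs_sub_le_tsum_of_superSolution (T := fun x F => siteAvg γ x F)
    (E₁ := fun F => ∫ σ, F σ ∂μ) (E₂ := fun F => ∫ σ, F σ ∂ν) hR hlip0 hlips hosc hC0 hCs hT hdust
    h₁le h₁ge h₁T h₂le h₂ge h₂D hb0 hc0 hc1 hrow hd0 hdD hsuper hF hδ'
  refine key.trans (le_of_eq ?_)
  rw [tsum_eq_sum (s := Δ) (fun y hy => by rw [if_neg hy, mul_zero])]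
  exact Finset.sum_congr rfl fun y hy => by rw [if_pos hy]

end States

end DobrushinMetric

end Literature.Probability.LatticeModels

end
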